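import Summits.SmoothPoincare4.SmoothPoincare4.Theorems.SymplecticOrigamiGromovRecognitionRelEndGluedBasics
import Mathlib.Analysis.Normed.Module.Convex
import Mathlib.Topology.Homotopy.Basic

/-!
# Glued maps of two members of a continuous family of two-chart pairs are homotopic
(registered helper `helper_gluedFamilyHomotopic` of line `cross-cap-laurent`, crux
`GromovRecognitionRelEnd`, item stmt-SmoothPoincare4-11009)

A (`J`-holomorphic) sphere in a space `X` is handled throughout the crux in *two-chart form*: a
pair `u v : ℂ → X` with `v z = u z⁻¹` for `z ≠ 0`, and its *glued map* `F : C(ℂℙ¹, X)` on the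
tree's `Literature.Topology.FourManifolds.ComplexProjectiveSpace 1`, characterised by
`F p = u (affineCoordComplex 0 p 0)` on the chart `CoordNeZero 0` (`w₀ ≠ 0`, coordinate `w₁ / w₀`)
and `F p = v (affineCoordComplex 1 p 0)` on the chart `CoordNeZero 1` (`w₁ ≠ 0`, coordinate
`w₀ / w₁`); see the sibling file `…GluedBasics` (existence, range, uniqueness of glued maps).

The local-foliation fact hands the lead a *family* `(U a, V a)`, `‖a‖ < ε`, of such pairs, jointly
continuous in `(a, z)` on `ball 0 ε × ℂ`.  This file proves `helper_gluedFamilyHomotopic`: the glued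
maps `F₀`, `F₁` of two members `a₀`, `a₁` of the family are homotopic.  Proof: run along the
straight segment `γ t = a₀ + t • (a₁ - a₀)`, which stays in the (convex) ball, and take as
homotopy `H (t, p)` the glued value of the pair `(U (γ t), V (γ t))` at `p`, i.e.
`U (γ t) (w₁ / w₀)` if `w₀ ≠ 0` and `V (γ t) (w₀ / w₁)` otherwise; on the overlap of the two charts
the two recipes agree by the compatibility `V a z = U a z⁻¹`.  Continuity of `H` on `I × ℂℙ¹`:
on each of the two open sets `I × {wᵢ ≠ 0}` (which cover) `H` is the continuous-on-`ball 0 ε × ℂ`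
map `(a, z) ↦ U a z` (resp. `V a z`) composed with `(t, p) ↦ (γ t, affineCoordComplex i p 0)`,
continuous there since the complex affine coordinate is continuous on its chart
(`GluedBasics.continuousOn_affineCoordComplex`).  The endpoint identities `H (0, ·) = F₀`,
`H (1, ·) = F₁` are the glued clauses of `F₀`, `F₁` (every point lies in one of the two charts,
`exists_coordNeZero`).  No `J`-holomorphicity is involved.

References: D. McDuff, D. Salamon, *J-holomorphic Curves and Symplectic Topology*, 2nd ed. (2012),
§4.2 (spheres as maps of `S² = ℂ ∪ {∞}` through the two charts `z`, `1/z`); C. Wendl, *Lectures on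
Holomorphic Curves in Symplectic and Contact Geometry*, Prop. 2.53 (local foliation by a family of
spheres).
-/

noncomputable section

-- the prescribed namespace `Summit.<P>.<Sub>.…` duplicates `SmoothPoincare4` (P = Sub)
set_option linter.dupNamespace false

open scoped Topology unitInterval
open Set Function
open Literature.Topology.FourManifolds Literature.Topology.FourManifolds.ComplexProjectiveSpace

namespace Summit.SmoothPoincare4.SmoothPoincare4.Theorems.GromovRecognitionRelEnd.CrossCapLaurent

namespace GluedFamilyHomotopic

open GluedBasics

/-! ### Continuity of a parametrised glued map -/

/-- **Chart-wise continuity of a parametrised glued map.**  Let `γ : T → ℂ` be continuous with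
values in `s`, let `U : ℂ → ℂ → X` be jointly continuous on `s × ℂ`, and let
`H : T × ℂℙ¹ → X` agree on `T × {wᵢ ≠ 0}` with `(t, p) ↦ U (γ t) (cᵢ p)`, `cᵢ p =
affineCoordComplex i p 0` the complex affine coordinate of the `i`-th chart.  Then `H` is
continuous on `T × {wᵢ ≠ 0}` (the affine coordinate is continuous on its chart). [folklore] -/
theorem continuousOn_prod_chart {X : Type*} [TopologicalSpace X] {T : Type*} [TopologicalSpace T]
    {s : Set ℂ} {γ : T → ℂ} (hγ : Continuous γ) (hγs : ∀ t, γ t ∈ s) {U : ℂ → ℂ → X}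
    (hU : ContinuousOn (fun q : ℂ × ℂ => U q.1 q.2) (s ×ˢ univ))
    {H : T × ComplexProjectiveSpace 1 → X} (i : Fin (1 + 1))
    (hH : ∀ t p, CoordNeZero i p → H (t, p) = U (γ t) (affineCoordComplex i p 0)) :
    ContinuousOn H (univ ×ˢ {p | CoordNeZero i p}) := by
  have hc : ContinuousOn
      (fun q : T × ComplexProjectiveSpace 1 => (γ q.1, affineCoordComplex i q.2 0))
      (univ ×ˢ {p | CoordNeZero i p}) :=
    (hγ.comp continuous_fst).continuousOn.prodMk
      (((continuous_apply 0).comp_continuousOn (continuousOn_affineCoordComplex i)).comp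
        continuousOn_snd fun q hq => hq.2)
  refine (hU.comp hc fun q _ => ⟨hγs q.1, mem_univ _⟩).congr ?_
  rintro ⟨t, p⟩ hq
  exact hH t p hq.2

/-- **Continuity of a parametrised glued map.**  With `γ : T → ℂ` continuous with values in `s`
and `U V : ℂ → ℂ → X` jointly continuous on `s × ℂ`, a map `H : T × ℂℙ¹ → X` which is
`(t, p) ↦ U (γ t) (c₀ p)` on `T × {w₀ ≠ 0}` and `(t, p) ↦ V (γ t) (c₁ p)` on `T × {w₁ ≠ 0}` is
continuous: the two open sets cover `T × ℂℙ¹` (`exists_coordNeZero`). [folklore] -/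
theorem continuous_prod_of_eq {X : Type*} [TopologicalSpace X] {T : Type*} [TopologicalSpace T]
    {s : Set ℂ} {γ : T → ℂ} (hγ : Continuous γ) (hγs : ∀ t, γ t ∈ s) {U V : ℂ → ℂ → X}
    (hU : ContinuousOn (fun q : ℂ × ℂ => U q.1 q.2) (s ×ˢ univ))
    (hV : ContinuousOn (fun q : ℂ × ℂ => V q.1 q.2) (s ×ˢ univ))
    {H : T × ComplexProjectiveSpace 1 → X}
    (h0 : ∀ t p, CoordNeZero 0 p → H (t, p) = U (γ t) (affineCoordComplex 0 p 0))
    (h1 : ∀ t p, CoordNeZero 1 p → H (t, p) = V (γ t) (affineCoordComplex 1 p 0)) :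
    Continuous H := by
  refine continuous_iff_continuousAt.2 ?_
  rintro ⟨t, p⟩
  rcases Fin.exists_fin_two.1 (exists_coordNeZero p) with hp | hp
  · exact (continuousOn_prod_chart hγ hγs hU 0 h0).continuousAt
      ((isOpen_univ.prod (isOpen_setOf_coordNeZero 0)).mem_nhds ⟨mem_univ _, hp⟩)
  · exact (continuousOn_prod_chart hγ hγs hV 1 h1).continuousAt
      ((isOpen_univ.prod (isOpen_setOf_coordNeZero 1)).mem_nhds ⟨mem_univ _, hp⟩)

/-! ### The parametrised glued map of a family along a path -/

/-- **The parametrised glued map.**  Given a path `γ : T → ℂ` with `‖γ t‖ < ε` and a family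
`(U a, V a)`, `‖a‖ < ε`, of compatible two-chart pairs (`V a z = U a z⁻¹` for `z ≠ 0`), there is a
map `H : T × ℂℙ¹ → X` with `H (t, [w₀ : w₁]) = U (γ t) (w₁ / w₀)` for `w₀ ≠ 0` and
`H (t, [w₀ : w₁]) = V (γ t) (w₀ / w₁)` for `w₁ ≠ 0`: define it by the first recipe on `{w₀ ≠ 0}`
and by the second elsewhere; on the overlap the two agree by the compatibility. [folklore] -/
theorem exists_prod_glued {X : Type*} {T : Type*} {ε : ℝ} {γ : T → ℂ} (hγε : ∀ t, ‖γ t‖ < ε)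
    {U V : ℂ → ℂ → X} (hUV : ∀ a : ℂ, ‖a‖ < ε → ∀ z : ℂ, z ≠ 0 → V a z = U a z⁻¹) :
    ∃ H : T × ComplexProjectiveSpace 1 → X,
      (∀ t p, CoordNeZero 0 p → H (t, p) = U (γ t) (affineCoordComplex 0 p 0)) ∧
      (∀ t p, CoordNeZero 1 p → H (t, p) = V (γ t) (affineCoordComplex 1 p 0)) := by
  classical
  refine ⟨fun q => if CoordNeZero 0 q.2 then U (γ q.1) (affineCoordComplex 0 q.2 0)
    else V (γ q.1) (affineCoordComplex 1 q.2 0), fun t p hp => if_pos hp, fun t p hp => ?_⟩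
  dsimp only
  by_cases hp0 : CoordNeZero 0 p
  · rw [if_pos hp0]
    induction p using ComplexProjectiveSpace.ind with
    | h w =>
      simp only [coordNeZero_mk] at hp0 hp
      rw [affineCoordComplex_zero_mk, affineCoordComplex_one_mk,
        hUV _ (hγε t) _ (div_ne_zero hp0 hp), inv_div]
  · exact if_neg hp0

end GluedFamilyHomotopic

open GluedFamilyHomotopic

/-- **Glued maps of two members of a continuous family of two-chart pairs are homotopic**
(registered stub `helper_gluedFamilyHomotopic` of line `cross-cap-laurent`, signature verbatim).
Let `(U a, V a)`, `‖a‖ < ε`, be a family of two-chart pairs `ℂ → X` (`V a z = U a z⁻¹` for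
`z ≠ 0`), jointly continuous in `(a, z) ∈ ball 0 ε × ℂ`, and let `F₀`, `F₁ : ℂℙ¹ → X` be glued
maps of the members `a₀`, `a₁`.  Then `F₀` and `F₁` are homotopic: the homotopy is the glued map of
`(U (γ t), V (γ t))` along the segment `γ t = a₀ + t • (a₁ - a₀)` in the convex ball
(McDuff–Salamon 2012, §4.2; Wendl, Prop. 2.53 for the family). [folklore] -/
theorem helper_gluedFamilyHomotopic : ∀ (X : Type) [TopologicalSpace X] (ε : ℝ) (U V : ℂ → ℂ → X) (a₀ a₁ : ℂ) (F₀ F₁ : C(ComplexProjectiveSpace 1, X)), ‖a₀‖ < ε → ‖a₁‖ < ε → ContinuousOn (fun q : ℂ × ℂ => U q.1 q.2) (Metric.ball 0 ε ×ˢ univ) → ContinuousOn (fun q : ℂ × ℂ => V q.1 q.2) (Metric.ball 0 ε ×ˢ univ) → (∀ a : ℂ, ‖a‖ < ε → ∀ z : ℂ, z ≠ 0 → V a z = U a z⁻¹) → (∀ p, CoordNeZero 0 p → F₀ p = U a₀ (affineCoordComplex 0 p 0)) → (∀ p, CoordNeZero 1 p → F₀ p = V a₀ (affineCoordComplex 1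 p 0)) → (∀ p, CoordNeZero 0 p → F₁ p = U a₁ (affineCoordComplex 0 p 0)) → (∀ p, CoordNeZero 1 p → F₁ p = V a₁ (affineCoordComplex 1 p 0)) → F₀.Homotopic F₁ := by
  intro X _ ε U V a₀ a₁ F₀ F₁ ha₀ ha₁ hU hV hUV h0₀ h1₀ h0₁ h1₁
  -- the straight segment from `a₀` to `a₁` inside the (convex) ball `‖a‖ < ε`
  obtain ⟨γ, hγc, hγε, hγ0, hγ1⟩ :
      ∃ γ : I → ℂ, Continuous γ ∧ (∀ t, ‖γ t‖ < ε) ∧ γ 0 = a₀ ∧ γ 1 = a₁ :=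
    ⟨fun t => a₀ + (t : ℝ) • (a₁ - a₀), by fun_prop, fun t => mem_ball_zero_iff.1
      ((convex_ball (0 : ℂ) ε).add_smul_sub_mem (mem_ball_zero_iff.2 ha₀)
        (mem_ball_zero_iff.2 ha₁) t.2), by simp, by simp⟩
  -- the glued map of the pair `(U (γ t), V (γ t))`, parametrised by `t ∈ I`
  obtain ⟨H, hH0, hH1⟩ := exists_prod_glued (T := I) hγε hUV
  have hHc : Continuous H :=
    continuous_prod_of_eq hγc (fun t => mem_ball_zero_iff.2 (hγε t)) hU hV hH0 hH1
  refine ⟨{ toFun := H, continuous_toFun := hHc, map_zero_left := ?_, map_one_left := ?_ }⟩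
  · -- at `t = 0` the parametrised glued map is a glued map of `(U a₀, V a₀)`, i.e. `F₀`
    intro p
    show H (0, p) = F₀ p
    rcases Fin.exists_fin_two.1 (exists_coordNeZero p) with hp | hp
    · rw [hH0 0 p hp, h0₀ p hp, hγ0]
    · rw [hH1 0 p hp, h1₀ p hp, hγ0]
  · -- at `t = 1` it is a glued map of `(U a₁, V a₁)`, i.e. `F₁`
    intro p
    show H (1, p) = F₁ p
    rcases Fin.exists_fin_two.1 (exists_coordNeZero p) with hp | hp
    · rw [hH0 1 p hp, h0₁ p hp, hγ1]
    · rw [hH1 1 p hp, h1₁ p hp, hγ1]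

end Summit.SmoothPoincare4.SmoothPoincare4.Theorems.GromovRecognitionRelEnd.CrossCapLaurent

end
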